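import Summits.QuantumFields.BalabanUV.Beta.FP.TowerH2Letters
import Summits.QuantumFields.BalabanUV.Beta.FP.WoundEvenFamilyParities
import Summits.QuantumFields.BalabanUV.Beta.CompositeOneShotJetsGraded

/-!
# `BalabanUV.Beta.FP.TowerH2LettersG` — road «FP», THE GRADED TWIN (σ_T) OF `FP.TowerH2Letters` (v7's pinned second H-jet letters), FILED UNDER director-ym g23 [DIRYM-G23-INBOX-9] ruling (1)
# «located repair σ_T `tabsComp ↦ tabsCompG`» and director-ym g24 [DIRYM-G24-INBOX-1] ruling (1) «LAND THE TYPED S-END-G» (J2C LEG B1 j344339: graded `a2` r_sec ≤ 5.3e−13 ∕ 8.0e−14,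
# ungraded ≥ 1.5e−2, free fit (−6561, −1, 54, 108, 54) — float64, zero binder weight).  WHAT: the TWO letters of `TowerH2Letters` whose statements display the record's MIXED table —
# `M₂_transpose` (section variable `hM₂ : M₂ b β = perF … (½•(M2Of 3 (Lc^(n+2)) (tabsCompG (n+2) …).mixFF 0 … + sgnK∘trK …)) …`) and **`H2f_transpose`** (includes `hM₂`) — re-displayed at the
# GRADED table `tabsCompG` (`mixFF := compMixG`, the located word of A2-LOCATE 547291ba); proofs VERBATIM; the table-free letters (`T₂_pair_symm`, `T₂_transpose`, `H2f_symm`,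
# `H2f_half_symm_eq`, `H2f_linear_left∕right`, the `sum_sum_*` algebra) are NOT twinned — S-END-G opens the originals.  WHY THIS FILE EXISTS (road xread CONCAT-FULL11, 2026-08-31):
# S-END-G with the original `H2f_transpose` does not elaborate — unifying its `hM₂` (`tabsComp`) against S-END-G's displayed `hM₂` (`tabsCompG`) sends `whnf` through `compMix` vs `compMixG`
# (deterministic time-out at 4·10⁶ heartbeats); with this twin the whole σ_T chain elaborates.  0 defs; [folklore] lemmas over OUR objects; nothing cited; no `def … : Prop`; 0 sorry; nothing of
# Bałaban's asserted (ABSOLUTE RULE); 0 estimates; 0∕4 row-D1 binders; NOT (C1), NOT (T-ID), NOT SDF, NOT D1, NEVER «G-an2-4 closed», NOT BetaPertH, NOT continuum, NOT Clay.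

HONEST DEPENDENCY (page 1, mandatory): continuum YM on T⁴ ⇐ BetaPertH ∧ nine spine estimates (0/9 proved); BetaPertH ⇐ (D1) ∧ (D4) ∧ CAP+tail;
G-an2-4 gates asym, D1 and NE2/3/4.  HONEST FRAMING (cell contract, verbatim): «discharging `BetaPertH` makes Bałaban's UV stability UNCONDITIONAL —
a real constructive-QFT result; it is NOT the continuum limit and NOT the Clay problem.»  ABSOLUTE RULE (cell charter, verbatim): «No internally-minted
statement may enter as a cited fact. Every hypothesis is either kernel-proved in this package or a verbatim quotation of a PUBLISHED theorem with page
reference. The manuscript(s) under audit are NOT citable for their own disputed steps — they are the thing under adjudication; programme-internal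
(2001/route/tribunal) claims are never citable.»  Road «FP» OWNER, b2b-balaban-beta-d1-p3 gen 73, 2026-08-31.  No existing file touched.
-/

noncomputable section

open scoped BigOperators

namespace Summit.QuantumFields.BalabanUV.Beta.FP.TowerH2LettersG

open Summit.QuantumFields.BalabanUV.Beta.FP.TowerH2Letters (T₂_transpose)

open Finset Matrix
open Literature.MathematicalPhysics.QuantumFieldTheory
open Literature.MathematicalPhysics.QuantumFieldTheory.Balaban1983to89
open Literature.MathematicalPhysics.QuantumFieldTheory.Balaban1983to89.Beta
open B4TorusKernel.MultiPeriod (translate)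
open B5Prop11Plancherel (fine)
open B6Lemma24Torus (pbox)
open AffineAveraging (Site)
open OneStepResolventKernel (Fib)
open WilsonBiStencil (wilsonW₂)
open BalabanStepW2 (M2Of)
open Summit.QuantumFields.BalabanUV.Beta.TameKernelCalculus (trK)
open Summit.QuantumFields.BalabanUV.Beta.BorderedHessian (sgnK)
open Summit.QuantumFields.BalabanUV.Beta.AxialDressingRooted (one_le_of_neZero)
open Summit.QuantumFields.BalabanUV.Beta.CompositeOneShotJetsGraded (tabsCompG)
open Summit.QuantumFields.BalabanUV.Beta.CompositeOneShotJetData (Roots Pins)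
open Summit.QuantumFields.BalabanUV.Beta.FP.KernelPeriodisationFib (Idx perF)
open Summit.QuantumFields.BalabanUV.Beta.FP.KernelPeriodisationFibLoc (dper)
open Summit.QuantumFields.BalabanUV.Beta.FP.TorusCompositeObjects (towerTorus)
open Summit.QuantumFields.BalabanUV.Beta.GAN24.SecondOrderReadersParity (parityEven_evenHalf)
open Summit.QuantumFields.BalabanUV.Beta.FP.WoundEvenFamilyParities (parityEven_tsum perF_dper_symm_ff_of_parityEven)

/-! ## §1 Generic algebra of the two sectors -/


section Tables

variable {Lc : ℕ} [NeZero Lc] (M : Fin (3 + 1) → ℕ) [∀ μ, NeZero (M μ)] (n : ℕ) (Pn : Pins)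
  (T₂ : ↥(pbox (towerTorus Lc (fine Lc M) (n + 1))) × Fin (3 + 1) → ↥(pbox (towerTorus Lc (fine Lc M) (n + 1))) × Fin (3 + 1) → Matrix (↥(pbox (towerTorus Lc (fine Lc M) (n + 1))) × Fin (3 + 1)) (↥(pbox (towerTorus Lc (fine Lc M) (n + 1))) × Fin (3 + 1)) ℝ)
  (hT₂ : ∀ b b' : ↥(pbox (towerTorus Lc (fine Lc M) (n + 1))) × Fin (3 + 1), T₂ b b' = (1 / 2 : ℝ) • ((perF (towerTorus Lc (fine Lc M) (n + 1)) (dper (towerTorus Lc (fine Lc M) (n + 1)) (fun X Z i₁ i₂ => ∑' m : Site (3 + 1),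
              ((1 / 2 : ℝ) • (wilsonW₂ 3 (Pn.T (n + 1 + 1)) b.2 (b.1 : Site (3 + 1)) b'.2 (translate (towerTorus Lc (fine Lc M) (n + 1)) (b'.1 : Site (3 + 1)) m)
                + sgnK (trK (wilsonW₂ 3 (Pn.T (n + 1 + 1)) b.2 (b.1 : Site (3 + 1)) b'.2 (translate (towerTorus Lc (fine Lc M) (n + 1)) (b'.1 : Site (3 + 1)) m))))) X Z i₁ i₂))).submatrix
            (fun b : ↥(pbox (towerTorus Lc (fine Lc M) (n + 1))) × Fin (3 + 1) => ((b.1, Sum.inl b.2) : Idx (towerTorus Lc (fine Lc M) (n + 1)) (Fib 3)))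
            (fun b : ↥(pbox (towerTorus Lc (fine Lc M) (n + 1))) × Fin (3 + 1) => ((b.1, Sum.inl b.2) : Idx (towerTorus Lc (fine Lc M) (n + 1)) (Fib 3)))
        + (perF (towerTorus Lc (fine Lc M) (n + 1)) (dper (towerTorus Lc (fine Lc M) (n + 1)) (fun X Z i₁ i₂ => ∑' m : Site (3 + 1),
              ((1 / 2 : ℝ) • (wilsonW₂ 3 (Pn.T (n + 1 + 1)) b'.2 (b'.1 : Site (3 + 1)) b.2 (translate (towerTorus Lc (fine Lc M) (n + 1)) (b.1 : Site (3 + 1)) m)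
                + sgnK (trK (wilsonW₂ 3 (Pn.T (n + 1 + 1)) b'.2 (b'.1 : Site (3 + 1)) b.2 (translate (towerTorus Lc (fine Lc M) (n + 1)) (b.1 : Site (3 + 1)) m))))) X Z i₁ i₂))).submatrix
            (fun b : ↥(pbox (towerTorus Lc (fine Lc M) (n + 1))) × Fin (3 + 1) => ((b.1, Sum.inl b.2) : Idx (towerTorus Lc (fine Lc M) (n + 1)) (Fib 3)))
            (fun b : ↥(pbox (towerTorus Lc (fine Lc M) (n + 1))) × Fin (3 + 1) => ((b.1, Sum.inl b.2) : Idx (towerTorus Lc (fine Lc M) (n + 1)) (Fib 3)))))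
  (M₂ : ↥(pbox (towerTorus Lc (fine Lc M) (n + 1))) × Fin (3 + 1) → ↥(pbox M) × Fin (3 + 1) → Matrix (↥(pbox (towerTorus Lc (fine Lc M) (n + 1))) × Fin (3 + 1)) (↥(pbox (towerTorus Lc (fine Lc M) (n + 1))) × Fin (3 + 1)) ℝ)

omit [∀ μ, NeZero (M μ)] in
/-- [folklore] each `ℳ̂₂ b β` is a symmetric matrix on the `ff` block. -/
theorem M₂_transpose
    (hM₂ : ∀ (b : ↥(pbox (towerTorus Lc (fine Lc M) (n + 1))) × Fin (3 + 1)) (β : ↥(pbox M) × Fin (3 + 1)), M₂ b β = (perF (towerTorus Lc (fine Lc M) (n + 1)) (dper (towerTorus Lc (fine Lc M) (n + 1)) (fun X Z i₁ i₂ => ∑' m : Site (3 + 1),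
                ((1 / 2 : ℝ) • (M2Of 3 (Lc ^ (n + 1 + 1)) (tabsCompG (n + 1 + 1) (one_le_of_neZero Lc) (Roots.ctr Lc).hr (Pn.cM (n + 1 + 1))).mixFF 0 b.2 (b.1 : Site (3 + 1)) β.2 (translate M (β.1 : Site (3 + 1)) m)
                  + sgnK (trK (M2Of 3 (Lc ^ (n + 1 + 1)) (tabsCompG (n + 1 + 1) (one_le_of_neZero Lc) (Roots.ctr Lc).hr (Pn.cM (n + 1 + 1))).mixFF 0 b.2 (b.1 : Site (3 + 1)) β.2 (translate M (β.1 : Site (3 + 1)) m))))) X Z i₁ i₂))).submatrix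
              (fun b : ↥(pbox (towerTorus Lc (fine Lc M) (n + 1))) × Fin (3 + 1) => ((b.1, Sum.inl b.2) : Idx (towerTorus Lc (fine Lc M) (n + 1)) (Fib 3)))
              (fun b : ↥(pbox (towerTorus Lc (fine Lc M) (n + 1))) × Fin (3 + 1) => ((b.1, Sum.inl b.2) : Idx (towerTorus Lc (fine Lc M) (n + 1)) (Fib 3))))
    (b : ↥(pbox (towerTorus Lc (fine Lc M) (n + 1))) × Fin (3 + 1)) (β : ↥(pbox M) × Fin (3 + 1)) : (M₂ b β)ᵀ = M₂ b β := by
  rw [hM₂]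
  ext p q
  simp only [Matrix.transpose_apply, Matrix.submatrix_apply]
  exact perF_dper_symm_ff_of_parityEven _ (parityEven_tsum _ fun m => parityEven_evenHalf _) q p

end Tables

/-! ## §3 The pin `hH₂f` and v5's three shape letters + PART 2's symmetrised display -/

section Pin

variable {Lc : ℕ} [NeZero Lc] (M : Fin (3 + 1) → ℕ) [∀ μ, NeZero (M μ)] (n : ℕ) (c : ℝ) (Pn : Pins) {κ : Type*}
  (hv : (κ → ℝ) → (↥(pbox (towerTorus Lc (fine Lc M) (n + 1))) × Fin (3 + 1) → ℝ))
  (hhvl : ∀ (r : ℝ) (x y : κ → ℝ), hv (r • x + y) = r • hv x + hv y)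
  (T₂ : ↥(pbox (towerTorus Lc (fine Lc M) (n + 1))) × Fin (3 + 1) → ↥(pbox (towerTorus Lc (fine Lc M) (n + 1))) × Fin (3 + 1) → Matrix (↥(pbox (towerTorus Lc (fine Lc M) (n + 1))) × Fin (3 + 1)) (↥(pbox (towerTorus Lc (fine Lc M) (n + 1))) × Fin (3 + 1)) ℝ)
  (hT₂ : ∀ b b' : ↥(pbox (towerTorus Lc (fine Lc M) (n + 1))) × Fin (3 + 1), T₂ b b' = (1 / 2 : ℝ) • ((perF (towerTorus Lc (fine Lc M) (n + 1)) (dper (towerTorus Lc (fine Lc M) (n + 1)) (fun X Z i₁ i₂ => ∑' m : Site (3 + 1),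
              ((1 / 2 : ℝ) • (wilsonW₂ 3 (Pn.T (n + 1 + 1)) b.2 (b.1 : Site (3 + 1)) b'.2 (translate (towerTorus Lc (fine Lc M) (n + 1)) (b'.1 : Site (3 + 1)) m)
                + sgnK (trK (wilsonW₂ 3 (Pn.T (n + 1 + 1)) b.2 (b.1 : Site (3 + 1)) b'.2 (translate (towerTorus Lc (fine Lc M) (n + 1)) (b'.1 : Site (3 + 1)) m))))) X Z i₁ i₂))).submatrix
            (fun b : ↥(pbox (towerTorus Lc (fine Lc M) (n + 1))) × Fin (3 + 1) => ((b.1, Sum.inl b.2) : Idx (towerTorus Lc (fine Lc M) (n + 1)) (Fib 3)))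
            (fun b : ↥(pbox (towerTorus Lc (fine Lc M) (n + 1))) × Fin (3 + 1) => ((b.1, Sum.inl b.2) : Idx (towerTorus Lc (fine Lc M) (n + 1)) (Fib 3)))
        + (perF (towerTorus Lc (fine Lc M) (n + 1)) (dper (towerTorus Lc (fine Lc M) (n + 1)) (fun X Z i₁ i₂ => ∑' m : Site (3 + 1),
              ((1 / 2 : ℝ) • (wilsonW₂ 3 (Pn.T (n + 1 + 1)) b'.2 (b'.1 : Site (3 + 1)) b.2 (translate (towerTorus Lc (fine Lc M) (n + 1)) (b.1 : Site (3 + 1)) m)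
                + sgnK (trK (wilsonW₂ 3 (Pn.T (n + 1 + 1)) b'.2 (b'.1 : Site (3 + 1)) b.2 (translate (towerTorus Lc (fine Lc M) (n + 1)) (b.1 : Site (3 + 1)) m))))) X Z i₁ i₂))).submatrix
            (fun b : ↥(pbox (towerTorus Lc (fine Lc M) (n + 1))) × Fin (3 + 1) => ((b.1, Sum.inl b.2) : Idx (towerTorus Lc (fine Lc M) (n + 1)) (Fib 3)))
            (fun b : ↥(pbox (towerTorus Lc (fine Lc M) (n + 1))) × Fin (3 + 1) => ((b.1, Sum.inl b.2) : Idx (towerTorus Lc (fine Lc M) (n + 1)) (Fib 3)))))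
  (hm : (κ → ℝ) → (↥(pbox M) × Fin (3 + 1) → ℝ))
  (hml : ∀ (r : ℝ) (x y : κ → ℝ), hm (r • x + y) = r • hm x + hm y)
  (M₂ : ↥(pbox (towerTorus Lc (fine Lc M) (n + 1))) × Fin (3 + 1) → ↥(pbox M) × Fin (3 + 1) → Matrix (↥(pbox (towerTorus Lc (fine Lc M) (n + 1))) × Fin (3 + 1)) (↥(pbox (towerTorus Lc (fine Lc M) (n + 1))) × Fin (3 + 1)) ℝ)
  (cM₂ : ℝ)
  -- THE v6 PIN of the second H-jet (SPEC-57 §4 (i)): Wilson bi-sector over `T̂₂` + mixed sector over `hm ∕ ℳ̂₂`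
  (H₂f : (κ → ℝ) → (κ → ℝ) → Matrix (↥(pbox (towerTorus Lc (fine Lc M) (n + 1))) × Fin (3 + 1)) (↥(pbox (towerTorus Lc (fine Lc M) (n + 1))) × Fin (3 + 1)) ℝ)
  (hH₂f : ∀ v v', H₂f v v' = (-2 * c) ^ 2 • ∑ b : ↥(pbox (towerTorus Lc (fine Lc M) (n + 1))) × Fin (3 + 1), ∑ b' : ↥(pbox (towerTorus Lc (fine Lc M) (n + 1))) × Fin (3 + 1), (hv v b * hv v' b') • T₂ b b'
      + cM₂ • ∑ b : ↥(pbox (towerTorus Lc (fine Lc M) (n + 1))) × Fin (3 + 1), ∑ β : ↥(pbox M) × Fin (3 + 1), (hv v b * hm v' β + hv v' b * hm v β) • M₂ b β)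

omit [∀ μ, NeZero (M μ)] in
include hT₂ hH₂f in
/-- [folklore] **`H2f_transpose` — v5's `hH₂t`**: `(H₂f v v)ᵀ = H₂f v v` (termwise `T₂_transpose ∕ M₂_transpose`). -/
theorem H2f_transpose
    (hM₂ : ∀ (b : ↥(pbox (towerTorus Lc (fine Lc M) (n + 1))) × Fin (3 + 1)) (β : ↥(pbox M) × Fin (3 + 1)), M₂ b β = (perF (towerTorus Lc (fine Lc M) (n + 1)) (dper (towerTorus Lc (fine Lc M) (n + 1)) (fun X Z i₁ i₂ => ∑' m : Site (3 + 1),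
                ((1 / 2 : ℝ) • (M2Of 3 (Lc ^ (n + 1 + 1)) (tabsCompG (n + 1 + 1) (one_le_of_neZero Lc) (Roots.ctr Lc).hr (Pn.cM (n + 1 + 1))).mixFF 0 b.2 (b.1 : Site (3 + 1)) β.2 (translate M (β.1 : Site (3 + 1)) m)
                  + sgnK (trK (M2Of 3 (Lc ^ (n + 1 + 1)) (tabsCompG (n + 1 + 1) (one_le_of_neZero Lc) (Roots.ctr Lc).hr (Pn.cM (n + 1 + 1))).mixFF 0 b.2 (b.1 : Site (3 + 1)) β.2 (translate M (β.1 : Site (3 + 1)) m))))) X Z i₁ i₂))).submatrix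
              (fun b : ↥(pbox (towerTorus Lc (fine Lc M) (n + 1))) × Fin (3 + 1) => ((b.1, Sum.inl b.2) : Idx (towerTorus Lc (fine Lc M) (n + 1)) (Fib 3)))
              (fun b : ↥(pbox (towerTorus Lc (fine Lc M) (n + 1))) × Fin (3 + 1) => ((b.1, Sum.inl b.2) : Idx (towerTorus Lc (fine Lc M) (n + 1)) (Fib 3))))
    (v : κ → ℝ) : (H₂f v v)ᵀ = H₂f v v := by
  rw [hH₂f]
  simp only [Matrix.transpose_add, Matrix.transpose_smul, Matrix.transpose_sum, T₂_transpose M n Pn T₂ hT₂, M₂_transpose M n Pn M₂ hM₂]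

end Pin

end Summit.QuantumFields.BalabanUV.Beta.FP.TowerH2LettersG

end
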